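import Summits.SmoothPoincare4.SmoothPoincare4.Theorems.ConvexBisectionAcyclicBisectionExistsChartedChainCycle
import Summits.SmoothPoincare4.SmoothPoincare4.Theorems.ConvexBisectionAcyclicBisectionExistsChartedChainSheets
import Summits.SmoothPoincare4.SmoothPoincare4.Theorems.ConvexBisectionAcyclicBisectionExistsChartedChainChordSign
import HarnessLib

/-!
# The passage loop of the PREVIOUS vanishing cycle
(wave 4, brick Y4-4c of the model chain (R2) `exists_charted_chain` for the missing lemma
`crossingNumber_eq_stdSymp` of node N1a of stub `stub_modelsOnFibred_of_reach` = NF4, line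
`modp-braid-orbits`, crux `ConvexBisection.AcyclicBisectionExists`, item stmt-SmoothPoincare4-10508;
registered sub-goal `helper_passageLoopPrev`)

Mirror image of `…ChartedChainPassageLoop.lean` for the sub-diagonal entry of the model chain: a
page loop in the class `chainVec g (2g−1)` of the PREVIOUS vanishing cycle (over
`[ζ_{2g−1}, ζ_{2g}]`, `ζ_{2g} = η̄`), namely the sheet loop over the `x`-path `gamP g` from `ζ_{2g−1}`
to `η̄` inside the closed unit disc

  `ζ_{2g−1} →` (straight) `→ x₁ = jX (i radP (−3/4)) →` (along the real axis: `jX (i radP r)`, `r`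
  from `−3/4` up to `3/4`, then `jX (iρ')`, `ρ'` from `radP (3/4)` down to `1`) `→ m →` (down the
  half-chord `jX (e^{i(2πv−π)})`) `→ η̄`,

out on the upper sheet, back on the lower (`passXP`).  On the way back over the real segment the
loop is the radial line `u = 1/4` of the chart traversed DOWNWARDS, from height `3/4` to `−3/4`
(the sequel counts it: crossing number `−1`).  Here: the path, its continuity and bounds, the page
loop (`helper_passageLoopPrev`) and its shadow **`chainVec g (2g−1)`** (a sheet family to the
`(2g−1)`-st chain loop).
Everything is proved; no `sorry`.  References: J. Milnor, *Singular points of complex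
hypersurfaces* (1968), §9 [Milnor1968]; A. Hatcher, *Algebraic Topology* (2002), Thm. 2A.1
[HatcherAT2002].
-/

noncomputable section

set_option linter.dupNamespace false

open scoped Manifold ContDiff Topology ComplexConjugate Real
open Set Function Metric Complex
open Literature.Topology.FourManifolds Literature.Topology.FourManifolds.LefschetzBase

namespace Summit.SmoothPoincare4.SmoothPoincare4.Theorems.AcyclicBisectionExists.ModpBraidOrbits

variable {g : ℕ} {c : ℂ}

/-! ## §1 The `x`-path -/

/-- The radius along the return segment: `radP g (3/4) → 1` as `v` runs over `[1/2, 3/4]`. [folklore] -/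
def rhoBP (g : ℕ) (v : ℝ) : ℝ := 1 + (3 - 4 * v) * (radP g (3 / 4) - 1)

/-- **The `x`-path `gamP g : [0, 1] → closed unit disc`** from `ζ_{2g−1}` to `η̄ = ζ_{2g}`: straight
segment, real segment (parametrised by the height `r = 6v − 9/4`, then by the radius), half-chord.
[folklore] -/
def gamP (g : ℕ) (v : ℝ) : ℂ :=
  if v ≤ 1 / 4 then branchPt g (2 * g - 1) + ((4 * v : ℝ) : ℂ) * (jX g (I * radP g (-(3 / 4))) - branchPt g (2 * g - 1))
  else if v ≤ 1 / 2 then jX g (I * radP g (6 * v - 9 / 4))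
  else if v ≤ 3 / 4 then jX g (I * rhoBP g v)
  else jX g (Complex.exp (((2 * π * v - π : ℝ) : ℂ) * I))

/-- **The `x`-coordinate of the previous passage loop**: out along `gamP` on `[0, 1/2]`, back on
`[1/2, 1]`. [folklore] -/
def passXP (g : ℕ) (τ : ℝ) : ℂ := if τ ≤ 1 / 2 then gamP g (2 * τ) else gamP g (2 - 2 * τ)

/-- `rhoBP` runs over `[1, radP (3/4)]` on `[1/2, 3/4]`. [folklore] -/
theorem rhoBP_mem (g : ℕ) {v : ℝ} (hv : v ∈ Icc (1 / 2 : ℝ) (3 / 4)) : 1 ≤ rhoBP g v ∧ rhoBP g v ≤ radP g (3 / 4) := by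
  have h := one_lt_radP g (3 / 4)
  unfold rhoBP
  constructor <;> nlinarith [hv.1, hv.2]

/-- `jX (e^{iπ}) = ζ_{2g}`. [folklore] -/
theorem jX_exp_pi (g : ℕ) : jX g (Complex.exp ((π : ℝ) * I)) = branchPt g (2 * g) := by
  rw [show 2 * g = 2 * g - 0 from rfl, branchPt_two_mul_sub (Nat.zero_le _), branchPt_zero_eq, jX_exp,
    Real.cos_pi, map_add, map_mul, Complex.conj_ofReal, Complex.conj_ofReal, Complex.conj_I]
  push_cast; ring

/-- The pieces of `gamP` on the four quarters. [folklore] -/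
theorem gamP_pieces (g : ℕ) (v : ℝ) :
    (v ∈ Icc (0 : ℝ) (1 / 4) → gamP g v = branchPt g (2 * g - 1) +
      ((4 * v : ℝ) : ℂ) * (jX g (I * radP g (-(3 / 4))) - branchPt g (2 * g - 1))) ∧
    (v ∈ Icc (1 / 4 : ℝ) (1 / 2) → gamP g v = jX g (I * radP g (6 * v - 9 / 4))) ∧
    (v ∈ Icc (1 / 2 : ℝ) (3 / 4) → gamP g v = jX g (I * rhoBP g v)) ∧
    (v ∈ Icc (3 / 4 : ℝ) 1 → gamP g v = jX g (Complex.exp (((2 * π * v - π : ℝ) : ℂ) * I))) := by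
  refine ⟨fun hv => by rw [gamP, if_pos hv.2], fun hv => ?_, fun hv => ?_, fun hv => ?_⟩
  · rcases eq_or_lt_of_le hv.1 with h | h
    · rw [← h, gamP, if_pos le_rfl]; norm_num
    · rw [gamP, if_neg (not_le.2 h), if_pos hv.2]
  · rcases eq_or_lt_of_le hv.1 with h | h
    · rw [← h, gamP, if_neg (by norm_num), if_pos le_rfl, rhoBP]; norm_num
    · rw [gamP, if_neg (by linarith), if_neg (not_le.2 h), if_pos hv.2]
  · rcases eq_or_lt_of_le hv.1 with h | h
    · rw [← h, gamP, if_neg (by norm_num), if_neg (by norm_num), if_pos le_rfl, rhoBP]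
      have e1 : (((2 * π * (3 / 4 : ℝ) - π : ℝ)) : ℂ) * I = π / 2 * I := by push_cast; ring
      have e2 : ((1 + (3 - 4 * (3 / 4 : ℝ)) * (radP g (3 / 4) - 1) : ℝ) : ℂ) = 1 := by push_cast; ring
      rw [e1, Complex.exp_pi_div_two_mul_I, e2, mul_one]
    · rw [gamP, if_neg (by linarith), if_neg (by linarith), if_neg (not_le.2 h)]

/-- End points of `gamP`: `gamP 0 = ζ_{2g−1}`, `gamP 1 = ζ_{2g}`. [folklore] -/
theorem gamP_ends (g : ℕ) : gamP g 0 = branchPt g (2 * g - 1) ∧ gamP g 1 = branchPt g (2 * g) := by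
  obtain ⟨hA, -, -, -⟩ := gamP_pieces g 0
  obtain ⟨-, -, -, hD⟩ := gamP_pieces g 1
  refine ⟨by rw [hA ⟨le_rfl, by norm_num⟩]; push_cast; ring, ?_⟩
  rw [hD ⟨by norm_num, le_rfl⟩, ← jX_exp_pi]
  congr 2; push_cast; ring

/-- **`gamP` is continuous on `[0, 1]`.** [folklore] -/
theorem continuousOn_gamP (g : ℕ) : ContinuousOn (gamP g) (Icc (0 : ℝ) 1) := by
  have hjXc : ∀ {f : ℝ → ℂ} {S : Set ℝ}, ContinuousOn f S → (∀ v ∈ S, f v ≠ 0) →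
      ContinuousOn (fun v => jX g (f v)) S := fun hf h0 v hv =>
    (continuousAt_jX g (h0 v hv)).comp_continuousWithinAt (hf v hv)
  have hIne : ∀ ρ : ℝ, 0 < ρ → I * (ρ : ℂ) ≠ 0 := fun ρ hρ =>
    mul_ne_zero I_ne_zero (by exact_mod_cast hρ.ne')
  have hA : ContinuousOn (fun v : ℝ => branchPt g (2 * g - 1) +
      ((4 * v : ℝ) : ℂ) * (jX g (I * radP g (-(3 / 4))) - branchPt g (2 * g - 1))) (Icc (0 : ℝ) (1 / 4)) :=
    Continuous.continuousOn (by fun_prop)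
  have hB : ContinuousOn (fun v : ℝ => jX g (I * radP g (6 * v - 9 / 4))) (Icc (1 / 4 : ℝ) (1 / 2)) :=
    hjXc (Continuous.continuousOn (by have := contDiff_radP g; fun_prop)) fun v _ => hIne _ (radP_pos g _)
  have hC : ContinuousOn (fun v : ℝ => jX g (I * rhoBP g v)) (Icc (1 / 2 : ℝ) (3 / 4)) :=
    hjXc (Continuous.continuousOn (by unfold rhoBP; fun_prop)) fun v hv => hIne _ (by linarith [(rhoBP_mem g hv).1])
  have hD : ContinuousOn (fun v : ℝ => jX g (Complex.exp (((2 * π * v - π : ℝ) : ℂ) * I))) (Icc (3 / 4 : ℝ) 1) :=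
    hjXc (Continuous.continuousOn (by fun_prop)) fun v _ => Complex.exp_ne_zero _
  have e : Icc (0 : ℝ) 1 = ((Icc (0 : ℝ) (1 / 4) ∪ Icc (1 / 4) (1 / 2)) ∪ Icc (1 / 2) (3 / 4)) ∪ Icc (3 / 4) 1 := by
    rw [Icc_union_Icc_eq_Icc (by norm_num) (by norm_num), Icc_union_Icc_eq_Icc (by norm_num) (by norm_num),
      Icc_union_Icc_eq_Icc (by norm_num) (by norm_num)]
  rw [e]
  refine ContinuousOn.union_of_isClosed (ContinuousOn.union_of_isClosed (ContinuousOn.union_of_isClosed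
    (hA.congr fun v hv => (gamP_pieces g v).1 hv) (hB.congr fun v hv => (gamP_pieces g v).2.1 hv) isClosed_Icc isClosed_Icc)
    (hC.congr fun v hv => (gamP_pieces g v).2.2.1 hv) (isClosed_Icc.union isClosed_Icc) isClosed_Icc)
    (hD.congr fun v hv => (gamP_pieces g v).2.2.2 hv) ((isClosed_Icc.union isClosed_Icc).union isClosed_Icc) isClosed_Icc

/-- **`gamP` stays in the closed unit disc** (`g ≥ 1`). [folklore] -/
theorem norm_gamP_le (hg : 1 ≤ g) {v : ℝ} (hv : v ∈ Icc (0 : ℝ) 1) : ‖gamP g v‖ ≤ 1 := by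
  obtain ⟨hA, hB, hC, hD⟩ := gamP_pieces g v
  have hR : ∀ r : ℝ, ‖jX g (I * radP g r)‖ ≤ 1 := fun r =>
    norm_jX_I_mul_le hg (one_lt_radP g r).le (radP_le_thirteen_twelfths hg r)
  by_cases h1 : v ≤ 1 / 4
  · rw [hA ⟨hv.1, h1⟩]
    have hl : (0 : ℝ) ≤ 4 * v := by linarith [hv.1]
    have hl1 : 4 * v ≤ (1 : ℝ) := by linarith
    calc ‖branchPt g (2 * g - 1) + ((4 * v : ℝ) : ℂ) * (jX g (I * radP g (-(3 / 4))) - branchPt g (2 * g - 1))‖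
        = ‖((1 - 4 * v : ℝ) : ℂ) * branchPt g (2 * g - 1) + ((4 * v : ℝ) : ℂ) * jX g (I * radP g (-(3 / 4)))‖ := by
          congr 1; push_cast; ring
      _ ≤ (1 - 4 * v) * 1 + 4 * v * 1 := by
          refine (norm_add_le _ _).trans ?_
          rw [norm_mul, norm_mul, Complex.norm_real, Complex.norm_real, Real.norm_eq_abs, Real.norm_eq_abs,
            abs_of_nonneg (by linarith), abs_of_nonneg hl, norm_branchPt]
          have := mul_le_mul_of_nonneg_left (hR (-(3 / 4))) hl
          linarith
      _ = 1 := by ring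
  by_cases h2 : v ≤ 1 / 2
  · rw [hB ⟨(not_le.1 h1).le, h2⟩]; exact hR _
  by_cases h3 : v ≤ 3 / 4
  · have hv' : v ∈ Icc (1 / 2 : ℝ) (3 / 4) := ⟨(not_le.1 h2).le, h3⟩
    rw [hC hv']
    exact norm_jX_I_mul_le hg (rhoBP_mem g hv').1 ((rhoBP_mem g hv').2.trans (radP_le_thirteen_twelfths hg _))
  · rw [hD ⟨(not_le.1 h3).le, hv.2⟩]; exact norm_jX_exp_le g _

/-- The pieces of `passXP`. [folklore] -/
theorem passXP_pieces (g : ℕ) (τ : ℝ) :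
    (τ ∈ Icc (0 : ℝ) (1 / 2) → passXP g τ = gamP g (2 * τ)) ∧ (τ ∈ Icc (1 / 2 : ℝ) 1 → passXP g τ = gamP g (2 - 2 * τ)) := by
  refine ⟨fun h => by rw [passXP, if_pos h.2], fun h => ?_⟩
  rcases eq_or_lt_of_le h.1 with e | e
  · rw [← e, passXP, if_pos le_rfl]; norm_num
  · rw [passXP, if_neg (not_le.2 e)]

/-- **`passXP` is continuous on `[0, 1]`, in the closed unit disc, closed, through `ζ_{2g−1}` at `0`
and `ζ_{2g}` at `1/2`.** [folklore] -/
theorem passXP_props (hg : 1 ≤ g) :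
    ContinuousOn (passXP g) (Icc (0 : ℝ) 1) ∧ (∀ τ ∈ Icc (0 : ℝ) 1, ‖passXP g τ‖ ≤ 1) ∧
      passXP g 0 = branchPt g (2 * g - 1) ∧ passXP g 1 = branchPt g (2 * g - 1) ∧ passXP g (1 / 2) = branchPt g (2 * g) := by
  obtain ⟨h0, h1⟩ := gamP_ends g
  refine ⟨?_, fun τ hτ => ?_, ?_, ?_, ?_⟩
  · rw [← Icc_union_Icc_eq_Icc (show (0 : ℝ) ≤ 1 / 2 by norm_num) (show (1 / 2 : ℝ) ≤ 1 by norm_num)]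
    refine ContinuousOn.union_of_isClosed ?_ ?_ isClosed_Icc isClosed_Icc
    · refine (((continuousOn_gamP g).comp (Continuous.continuousOn (by fun_prop)) fun τ hτ =>
        ⟨by linarith [hτ.1], by linarith [hτ.2]⟩).congr fun τ hτ => (passXP_pieces g τ).1 hτ)
    · refine (((continuousOn_gamP g).comp (Continuous.continuousOn (by fun_prop)) fun τ hτ =>
        ⟨by linarith [hτ.2], by linarith [hτ.1]⟩).congr fun τ hτ => (passXP_pieces g τ).2 hτ)
  · by_cases h : τ ≤ 1 / 2
    · rw [(passXP_pieces g τ).1 ⟨hτ.1, h⟩]; exact norm_gamP_le hg ⟨by linarith [hτ.1], by linarith⟩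
    · rw [(passXP_pieces g τ).2 ⟨(not_le.1 h).le, hτ.2⟩]
      exact norm_gamP_le hg ⟨by linarith [hτ.2], by linarith [not_le.1 h]⟩
  · rw [(passXP_pieces g 0).1 ⟨le_rfl, by norm_num⟩, mul_zero, h0]
  · rw [(passXP_pieces g 1).2 ⟨by norm_num, le_rfl⟩]; norm_num; exact h0
  · rw [(passXP_pieces g (1 / 2)).1 ⟨by norm_num, le_rfl⟩]; norm_num; exact h1

/-! ## §2 The loop and its shadow -/

/-- **Sub-goal `helper_passageLoopPrev`** (Y4-4c of the model chain (R2) for node N1a of NF4): for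
`g ≥ 1` and `‖c‖ ≤ 1` there is a continuous page loop `K : 𝕊¹ → page g c` tracing on `[0, 1]` the
sheet loop over `passXP g`, with homology shadow `chainVec g (2g − 1)` (a sheet family to the
`(2g−1)`-st chain loop). [cite: Milnor1968, Thm. 9.1] -/
theorem helper_passageLoopPrev : ∀ (g : ℕ) (c : ℂ) (_hg : 1 ≤ g) (_hc : ‖c‖ ≤ 1), ∃ (K : Metric.sphere (0 : EuclideanSpace ℝ (Fin 2)) 1 → Literature.Topology.FourManifolds.LefschetzBase.Base g) (hK : Continuous K), (∀ θ, K θ ∈ Literature.Topology.FourManifolds.LefschetzBase.page g c) ∧ (∀ τ ∈ Set.Icc (0 : ℝ) 1, (K (Literature.Topology.FourManifolds.circlePt τ)).1 = Summit.SmoothPoincare4.SmoothPoincare4.Theorems.AcyclicBisectionExists.ModpBraidOrbits.sheetAmb g c τ (Summit.SmoothPoincare4.SmoothPoincare4.Theorems.AcyclicBisectionExists.ModpBraidOrbits.passXP g τ)) ∧ Literature.Topology.FourManifolds.LefschetzBase.shadow g K hK = Literature.Topology.FourManifolds.LefschetzBase.chainVec g (2 * g - 1) := by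
  intro g c hg hc
  obtain ⟨hXc, hX1, hX0, hX1', hXh⟩ := passXP_props (g := g) hg
  have hb0 : passXP g 0 ^ (2 * g + 1) + 1 = 0 := by rw [hX0, branchPt_pow, neg_add_cancel]
  have hbh : passXP g (1 / 2) ^ (2 * g + 1) + 1 = 0 := by rw [hXh, branchPt_pow, neg_add_cancel]
  obtain ⟨K, hK, hKτ, hKp⟩ := exists_sheetCircle hc (passXP g) hXc hX1 (hX0.trans hX1'.symm) hb0 hbh
  obtain ⟨K₂, hK₂, hK₂u⟩ := exists_chainCircle g (2 * g - 1)
  refine ⟨K, hK, hKp, hKτ, ?_⟩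
  rw [← helper_shadow_sheetLoop_chain g (2 * g - 1) (by omega) K₂ hK₂ hK₂u]
  symm
  obtain ⟨hz0, hz1, hzh⟩ := chordZig_ends g (2 * g - 1)
  rw [show 2 * g - 1 + 1 = 2 * g by omega] at hzh
  refine shadow_eq_of_sheet_family hc (fun s => s) continuousOn_id (fun s hs => by rw [abs_of_nonneg hs.1]; exact hs.2)
    (fun s τ => ((1 - s : ℝ) : ℂ) * chordZig g (2 * g - 1) τ + (s : ℂ) * passXP g τ) ?_ ?_ ?_ ?_ ?_ hK₂ hK ?_ ?_
  · have h1 : ContinuousOn (fun p : ℝ × ℝ => passXP g p.2) (Icc (0 : ℝ) 1 ×ˢ Icc (0 : ℝ) 1) :=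
      hXc.comp continuousOn_snd fun p hp => hp.2
    have h2 : Continuous fun p : ℝ × ℝ => chordZig g (2 * g - 1) p.2 := (continuous_chordZig g _).comp continuous_snd
    exact ((Complex.continuous_ofReal.comp (continuous_const.sub continuous_fst)).continuousOn.mul h2.continuousOn).add
      ((Complex.continuous_ofReal.comp continuous_fst).continuousOn.mul h1)
  · intro s hs τ hτ
    calc ‖((1 - s : ℝ) : ℂ) * chordZig g (2 * g - 1) τ + (s : ℂ) * passXP g τ‖
        ≤ ‖((1 - s : ℝ) : ℂ) * chordZig g (2 * g - 1) τ‖ + ‖(s : ℂ) * passXP g τ‖ := norm_add_le _ _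
      _ ≤ (1 - s) * 1 + s * 1 := by
          rw [norm_mul, norm_mul, Complex.norm_real, Complex.norm_real, Real.norm_eq_abs, Real.norm_eq_abs,
            abs_of_nonneg (by linarith [hs.2]), abs_of_nonneg hs.1]
          have e1 := mul_le_mul_of_nonneg_left (norm_chordZig_le g (2 * g - 1) hτ) (by linarith [hs.2] : (0 : ℝ) ≤ 1 - s)
          have e2 := mul_le_mul_of_nonneg_left (hX1 τ hτ) hs.1
          linarith
      _ = 1 := by ring
  · intro s _; rw [hz0, hz1, hX0, hX1']
  · intro s _
    rw [hz0, hX0, show ((1 - s : ℝ) : ℂ) * branchPt g (2 * g - 1) + (s : ℂ) * branchPt g (2 * g - 1) = branchPt g (2 * g - 1) by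
      push_cast; ring, branchPt_pow, neg_add_cancel]
  · intro s _
    rw [hzh, hXh, show ((1 - s : ℝ) : ℂ) * branchPt g (2 * g) + (s : ℂ) * branchPt g (2 * g) = branchPt g (2 * g) by
      push_cast; ring, branchPt_pow, neg_add_cancel]
  · intro τ hτ; rw [hK₂u τ hτ]; simp
  · intro τ hτ; rw [hKτ τ hτ]; simp

end Summit.SmoothPoincare4.SmoothPoincare4.Theorems.AcyclicBisectionExists.ModpBraidOrbits

end
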